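import Summits.ValiantsHypothesis.ValiantsHypothesis.Statement
import Literature.Computability.AlgebraicComplexity.DawarWilsenach2025Thm71
import Literature.Computability.AlgebraicComplexity.ValiantConjectureEquivProofs
import HarnessLib

/-!
# The symmetrization bridge: `VP ∩ MatSym ⊆ symVP_{2^{o(n)}}` implies Valiant's hypothesis over `ℂ`

Solo seat `solo-ValiantsHypothesis-blind` (session 7).  This file types the ONE load-bearing
statement of the "symmetric circuits" line toward `VP ≠ VNP` and proves that it suffices.

* `MatrixSymmetrizationHypothesis` (SC) — every p-computable p-family `(f_n)` of
  MATRIX-SYMMETRIC polynomials (`f_n ∈ ℂ[x_ij : i, j < n]` invariant under independent row and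
  column permutations, `Sym_n × Sym_n`) is computed by SQUARE-SYMMETRIC labelled arithmetic
  circuits (Dawar–Wilsenach, Def. 3.7, diagonal action of `Sym_n`) of orbit size `2^{o(n)}`
  (`∀ ε > 0`, eventually `ORB(C_n) < 2^{ε n}`).  This is the negative answer to the third open
  question of Dwivedi–Pago–Seppelt (STOC 2026, arXiv:2601.09343, §4: "Are there linear combinations
  (p_n) of homomorphism polynomials of linear volume and polynomial dimension such that max tw(p_n)
  is unbounded but (p_n) ∈ VP …? If not, then symVP and VP would coincide on all matrix-symmetric
  polynomials"), in the weakest form that still decides the summit: strongest premise (full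
  `Sym_n × Sym_n` invariance, p-family AND p-computable), weakest conclusion (square symmetry,
  sub-exponential rather than polynomial orbit size).  STATUS: OPEN.  Its slice for single
  homomorphism polynomials is EQUIVALENT to `VFPT ≠ VW` (ibid., Cor. 3.6), which already implies
  `VP ≠ VNP`; the linear-volume case containing the permanent has no conditional result; the one
  unconditional symmetrization theorem (Bläser–Jindal 2018, fully `Sym_n`-symmetric polynomials)
  rests on `ℂ[x]^{Sym_n}` being a polynomial ring and has no analogue for `Sym_n × Sym_n`, whose
  invariant ring is generated by orbit sums of monomials such as `per_n` itself.  So SC is recorded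
  as a hypothesis `def`, never as a fact.
* `valiantsHypothesis_of_matrixSymmetrization` — SC → `ValiantsHypothesis`.  Proof: if
  `VP_ℂ = VNP_ℂ` then `PER` is p-computable (`perNotPComputableComplex_iff_holds`, von zur Gathen
  1987 Prop. 4.8 / Bürgisser 2000 Rem. 2.11); `PER` is a matrix-symmetric p-family
  (`perPoly_rename_prodMap`, `isPFamily_perPoly_holds`); SC then gives square-symmetric circuits
  of orbit size `2^{o(n)}` for `PER`, contradicting Dawar–Wilsenach 2025 Thm. 7.1, which is PROVED
  in the tree (`DawarWilsenach2025_thm71_holds`).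
* `perPoly_rename_prodMap` — `PER_n` is invariant under `x_ij ↦ x_{σ i, τ j}` (elementary).

References: A. Dawar, G. Wilsenach, *Symmetric arithmetic circuits*, Theory of Computing 21
(2025), Thm. 7.1 (p. 18), Def. 3.7; A. Dawar, B. Pago, T. Seppelt, *Symmetric algebraic circuits
and homomorphism polynomials*, ITCS 2026 (arXiv:2502.06740), Thm. 1.1; P. Dwivedi, B. Pago,
T. Seppelt, *Lower bounds in algebraic complexity via symmetry and homomorphism polynomials*,
STOC 2026 (arXiv:2601.09343), Cor. 3.6 and §4; M. Bläser, G. Jindal, *On the complexity of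
symmetric polynomials*, ITCS 2019.
-/

noncomputable section

namespace Summit.ValiantsHypothesis.ValiantsHypothesis.Theorems

open Literature.Computability.AlgebraicComplexity Filter

/-- `PER_n` is matrix-symmetric: renaming `x_{ij} ↦ x_{σ i, τ j}` fixes it (reindex the
permutation sum by `π ↦ σ π τ⁻¹`). [folklore] -/
theorem perPoly_rename_prodMap {n : ℕ} (σ τ : Equiv.Perm (Fin n)) :
    MvPolynomial.rename (Prod.map σ τ) (perPoly (Fin n) ℂ) = perPoly (Fin n) ℂ := by
  simp only [perPoly, Matrix.permanent, map_sum, map_prod, Matrix.mvPolynomialX_apply,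
    MvPolynomial.rename_X, Prod.map_apply]
  refine Fintype.sum_equiv ((Equiv.mulLeft σ).trans (Equiv.mulRight τ⁻¹)) _ _ fun π => ?_
  refine Fintype.prod_equiv τ _ _ fun i => ?_
  simp [Equiv.Perm.mul_apply]

/-- **SC, the matrix-symmetrization hypothesis** (OPEN; Dwivedi–Pago–Seppelt 2026, §4, third
question, negative answer, in its weakest summit-deciding form): every p-computable p-family of
`Sym_n × Sym_n`-invariant polynomials in the `n × n` variable matrix over `ℂ` is computed by a
family of square-symmetric labelled arithmetic circuits (Dawar–Wilsenach Def. 3.7, diagonal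
`Sym_n`) whose orbit sizes are `2^{o(n)}`.  A hypothesis, used only as such.
[cite: DwivediPagoSeppelt2026, §4 (third question) and Cor. 3.6] -/
@[conjecture] def MatrixSymmetrizationHypothesis : Prop :=
  ∀ f : (n : ℕ) → MvPolynomial (Fin n × Fin n) ℂ,
    IsPFamily f → IsPComputable f →
    (∀ n (σ τ : Equiv.Perm (Fin n)), MvPolynomial.rename (Prod.map σ τ) (f n) = f n) →
    ∃ (G : ℕ → Type) (_ : ∀ n, Fintype (G n))
      (C : ∀ n, LabelledArithCircuit ℂ (Fin n × Fin n) Unit (G n)),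
      (∀ n, (C n).IsSymmetric (Equiv.Perm (Fin n))) ∧
      (∀ n, (C n).eval ((C n).output ()) = f n) ∧
      ∀ ε : ℝ, 0 < ε → ∀ᶠ n : ℕ in atTop,
        ((C n).orbitSize (Equiv.Perm (Fin n)) : ℝ) < (2 : ℝ) ^ (ε * n)

/-- **The symmetrization bridge**: SC implies Valiant's hypothesis `VP_ℂ ≠ VNP_ℂ`, by
Dawar–Wilsenach 2025 Thm. 7.1 (proved in the tree) and the completeness of the permanent.
[cite: DawarWilsenach2025, Thm. 7.1 (p. 18)] -/
theorem valiantsHypothesis_of_matrixSymmetrization (hSC : MatrixSymmetrizationHypothesis) :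
    ValiantsHypothesis := by
  by_contra hS
  have hper : IsPComputable (fun n => perPoly (Fin n) ℂ) := by
    by_contra h
    exact hS (perNotPComputableComplex_iff_holds.mp h)
  obtain ⟨G, hG, C, hsym, hev, hsmall⟩ :=
    hSC (fun n => perPoly (Fin n) ℂ) isPFamily_perPoly_holds hper
      (fun n σ τ => perPoly_rename_prodMap σ τ)
  obtain ⟨ε, hε, hfreq⟩ := DawarWilsenach2025_thm71_holds ℂ G C hsym hev
  obtain ⟨n, hle, hlt⟩ := (hfreq.and_eventually (hsmall ε hε)).exists
  exact absurd hle (not_le.mpr hlt)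

end Summit.ValiantsHypothesis.ValiantsHypothesis.Theorems
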